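/-
Copyright (c) 2026 the pub-hodgecm-mathlib formalisation cell (harness21).  Prover seat hodgecm-mathlib-R90-C133-p02 (g0), Track B ∕ R90-TF, h413 = `stmt-HodgeConjecture-24833`,
R90-TF section S8 «ContSpec-n½» (S8-R149 (3) «PAIR DET-TWIST N = 3», FILE A; census `R90/S8/CENSUS-PairDetTwistU3.R90-C133-p02-g0.md`): the value of `ψ ∘ det` on the Borel of
`U(J₃)` and the `ψ∘det`-twist of the `(χ₁, χ₂)`-pair section spaces — the `N = 3` twin of ★ `K2E1ChiDetCharTorusDescentU2.detChar_borel_two`.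
-/
import Summits.HodgeConjecture.HodgeConjecture.Theorems.K2E1ChiSectionSpaceU3PairDefs      -- ★ `chiSectionSpacePair`, brings ★ `IsChiSectionPair`, `firstEntryUnit`, `middleEntryUnitary`, `diagEntryUnit`, `conjAdele_diagEntryUnit_mul_diagEntryUnit_rev`
import Literature.NumberTheory.Automorphic.UnitaryGroupDetCharacter                        -- ★ `detChar`, `detChar_apply`, `cmDetChar`, `coe_adelicDet`
import Literature.NumberTheory.Automorphic.UnitaryGroupAdelicOneTorusDictionary            -- ★ `adelicOneEquivTorus` (identity on ideles)
import Literature.NumberTheory.Automorphic.UnitaryGroupAdelicOneTorus                      -- ★ `val_smul_eq_conjAdele`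
import Literature.NumberTheory.Automorphic.Arthur2013.Leaves.TorusDictionary               -- ★ `TorusDict.pullback`, `twistToTorus`, `Herbrand.twist_apply`
import HarnessLib

/-!
# K2·E1 ∕ R90·S8 — `K2E1ChiDetCharBorelU3` (PAIR DET-TWIST, FILE A): `(ψ∘det)(b) = ψ̃(b₀₀)⁻¹ · ψ(b₁₁)` ON THE BOREL OF `U(J₃)`, AND THE `ψ∘det`-TWIST OF THE PAIR SECTION SPACES
# `V(χ₁, χ₂; K′, ω) · (ψ∘det) ⊆ V(χ₁·ψ̃⁻¹, χ₂·ψ; K′, ω·(ψ∘det)|_{K′})`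

Track B ∕ R90-TF, crux h413 = `stmt-HodgeConjecture-24833`, route of record `HCCMUnconditional`; cell `hodgecm-mathlib`, R90-TF section S8 «ContSpec-n½», the (V)(i) road (continued family
`Ec hE2 hE4` of the PAIR block `(ξ.bcη⁻¹·ξ.bcψ⁻¹·μω, ξ.ψ)` by TWIST from the single-character block `(ξ.bcη⁻¹·μω, 1)`; FILE B `K2E1ChiEisensteinDetTwistU3` transports the clauses).
THEOREMS ONLY (no `def`, no `instance`, no `notation`, no named-fact hypothesis, no `sorry`; default heartbeats); lane `--supports stmt-HodgeConjecture-24833 --as helper` (count-neutral).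
CLOSES NO SOCKET.  Generic quadratic datum `(F, E, c)` with `[E : F] = 2`, `c ≠ 1`, `U(J₃)`.

THE MATHEMATICS ([Rogawski1990, §1.10 p. 9, §12.1 p. 171, §13.3 p. 202]; [GelbartRogawski1991, §3.1 Remark p. 457]).  For `b ∈ B(𝔸_F) ≤ U(J₃)(𝔸_F)` (upper triangular) `det b = b₀₀·b₁₁·b₂₂`
with `b₂₂ = (c b₀₀)⁻¹` (unitarity on the diagonal, ★ `conjAdele_diagEntryUnit_mul_diagEntryUnit_rev`) and `b₁₁ ∈ U(1)(𝔸_F)` (★ `middleEntryUnitary`), so in the torus `T(𝔸_F)`: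
`det b = (c•b₀₀∕b₀₀)⁻¹ · b₁₁ = (twistToTorus b₀₀)⁻¹ · b₁₁`, and for an automorphic `ψ` of `U(1)(𝔸_F)`: **`(ψ∘det)(b) = ψ̃(b₀₀)⁻¹ · ψ(b₁₁)`**, `ψ̃ = TorusDict.pullback ψ` (`z ↦ ψ(c•z∕z)`; at a
one-dimensional `ξ` of `H`, `pullback ξ.ψ = ξ.bcψ` by `rfl`).  Consequently multiplication by `Θ = ψ∘det` (multiplicative on `G(𝔸_F)`) sends a `(χ₁, χ₂)`-pair section to a
`(χ₁·ψ̃⁻¹, χ₂·ψ)`-pair section and preserves every level `K′`, twisting the `K′`-type `ω` by `Θ|_{K′}` — the S8 dictionary «`ψ(α∕ᾱ) = (ξ.bcψ α)⁻¹`, `χ₂ = ξ.ψ` on the middle entry».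
* §1 `det_adelicVal_eq_of_mem_borelAdelic` (`det b = b₀₀ b₁₁ b₂₂` as ideles), `diagEntryUnit_two_eq` (`b₂₂ = (c•b₀₀)⁻¹`), `adelicOneEquivTorus_adelicDet_borel_three`, **`detChar_borel_three`**.
* §2 **`isChiSectionPair_mul_detChar`**, **`mul_detChar_mem_chiSectionSpacePair`** (the twist of `V(χ₁, χ₂; K′, ω)`).
HONEST LABEL: HC_CM is proved only modulo the 7 printed citations (2 remaining named inputs: hLiu418 = `stmt-HodgeConjecture-24832`, h413 = `stmt-HodgeConjecture-24833`) until
rung 0 closes; REL ≠ ★ ≠ BUILT; letter-free; asserts no named fact and closes no socket; count-neutral.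

## References
* [Rogawski1990] J. D. Rogawski, *Automorphic Representations of Unitary Groups in Three Variables* (1990), §1.10 p. 9, §12.1 p. 171, §13.3 p. 202.
* [GelbartRogawski1991] S. Gelbart, J. Rogawski, *L-functions and Fourier–Jacobi coefficients for the unitary group U(3)*, Invent. Math. 105 (1991), §3.1 Remark p. 457.
-/

set_option autoImplicit false
set_option linter.dupNamespace false  -- the mandated `…HodgeConjecture.HodgeConjecture.Cruxes.H413…` namespace repeats the summit's segment

noncomputable section

open NumberField IsDedekindDomain
open scoped MatrixGroups
open Literature.NumberTheory.Automorphic Literature.NumberTheory.Automorphic.UnitaryGroup Literature.NumberTheory.GaloisRepresentations AdelicGroupData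
open Literature.NumberTheory.Automorphic.Arthur2013.Leaves.TECR
open Summit.HodgeConjecture.HodgeConjecture.Cruxes.H413.K2E1BorelEisensteinU
open Summit.HodgeConjecture.HodgeConjecture.Cruxes.H413.K2E1CharacterEisensteinU2Defs
open Summit.HodgeConjecture.HodgeConjecture.Cruxes.H413.K2E1CharacterEisensteinU3PairDefs
open Summit.HodgeConjecture.HodgeConjecture.Cruxes.H413.K2E1ChiSectionSpaceU3PairDefs

namespace Summit.HodgeConjecture.HodgeConjecture.Cruxes.H413.K2E1ChiDetCharBorelU3

variable {F E : Type} [Field F] [NumberField F] [Field E] [NumberField E] [Algebra F E] {c : E ≃ₐ[F] E}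
  (h2 : Module.finrank F E = 2) (hc : c ≠ 1) (hJ : ((StdForm.antidiagonal 3).over E).det ≠ 0)

/-! ## §1 `(ψ∘det)(b) = ψ̃(b₀₀)⁻¹ · ψ(b₁₁)` on `B(𝔸_F) ≤ U(J₃)(𝔸_F)` -/

/-- **`det b = b₀₀ · b₁₁ · b₂₂`** as ideles for `b ∈ B(𝔸_F)` (upper triangular: Mathlib `Matrix.det_of_upperTriangular`). [cite: Rogawski1990, §1.10 p. 9] -/
theorem det_adelicVal_eq_of_mem_borelAdelic {b : (quasiSplit F E c 3).Adelic} (hb : b ∈ borelAdelic F E c 3) :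
    Matrix.GeneralLinearGroup.det (adelicVal F E c 3 ((StdForm.antidiagonal 3).over E) b) = diagEntryUnit hb 0 * diagEntryUnit hb 1 * diagEntryUnit hb 2 :=
  Units.ext (by
    rw [Matrix.GeneralLinearGroup.val_det_apply, Matrix.det_of_upperTriangular ((mem_borelAdelic_iff b).1 hb), Fin.prod_univ_three, Units.val_mul, Units.val_mul,
      coe_diagEntryUnit, coe_diagEntryUnit, coe_diagEntryUnit])

/-- **`b₂₂ = (c • b₀₀)⁻¹`** for `b ∈ B(𝔸_F) ≤ U(J₃)(𝔸_F)` (the unitarity law on the diagonal, ★ `conjAdele_diagEntryUnit_mul_diagEntryUnit_rev` at `i = 0`, `rev 0 = 2`).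
[cite: Rogawski1990, §1.9 p. 8] -/
theorem diagEntryUnit_two_eq {b : (quasiSplit F E c 3).Adelic} (hb : b ∈ borelAdelic F E c 3) : diagEntryUnit hb 2 = (c • diagEntryUnit hb 0)⁻¹ := by
  refine eq_inv_of_mul_eq_one_right (Units.ext ?_)
  rw [Units.val_mul, val_smul_eq_conjAdele, Units.val_one]
  have h := conjAdele_diagEntryUnit_mul_diagEntryUnit_rev hb 0
  rwa [show (0 : Fin 3).rev = 2 from by decide] at h

/-- **`det b` read in the torus `T(𝔸_F)`: `det b = (twistToTorus b₀₀)⁻¹ · b₁₁`** (`twistToTorus z = c•z∕z`; ★ `adelicOneEquivTorus` is the identity on ideles). [cite: Rogawski1990, §1.10 p. 9] -/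
theorem adelicOneEquivTorus_adelicDet_borel_three {b : (quasiSplit F E c 3).Adelic} (hb : b ∈ borelAdelic F E c 3) :
    adelicOneEquivTorus F E c (adelicDet F E c 3 ((StdForm.antidiagonal 3).over E) hJ b) = (TorusDict.twistToTorus c h2 hc (firstEntryUnit hb))⁻¹ * middleEntryUnitary hb := by
  refine Subtype.ext ?_
  rw [coe_adelicOneEquivTorus, coe_adelicDet, ← adelicVal_apply, det_adelicVal_eq_of_mem_borelAdelic hb, diagEntryUnit_two_eq hb, Subgroup.coe_mul, Subgroup.coe_inv,
    TorusDict.coe_twistToTorus_apply, Herbrand.twist_apply, coe_middleEntryUnitary, inv_div, firstEntryUnit_eq_diagEntryUnit_zero, div_eq_mul_inv, mul_right_comm]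

/-- **`(ψ∘det)(b) = ψ̃(b₀₀)⁻¹ · ψ(b₁₁)` ON THE BOREL OF `U(J₃)`** for an automorphic character `ψ` of `U(1)(𝔸_F)`, `ψ̃ = TorusDict.pullback ψ` — the `N = 3` twin of ★ `detChar_borel_two`
(where the middle factor is absent). [cite: GelbartRogawski1991, §3.1 Remark p. 457] [cite: Rogawski1990, §13.3 p. 202] -/
theorem detChar_borel_three (ψ : ↥(TorusDict.torus c) →ₜ* ℂˣ) (hψ : TorusDict.IsAutomorphic c ψ) {b : (quasiSplit F E c 3).Adelic} (hb : b ∈ borelAdelic F E c 3) :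
    detChar F E c h2 hc 3 ((StdForm.antidiagonal 3).over E) ψ hψ hJ b = (TorusDict.pullback c h2 hc ψ hψ)⁻¹ (firstEntryUnit hb) * ψ (middleEntryUnitary hb) := by
  rw [detChar_apply, adelicOneEquivTorus_adelicDet_borel_three h2 hc hJ hb, map_mul, map_inv, HeckeCharacter.inv_apply, TorusDict.pullback_apply]

/-! ## §2 The `ψ∘det`-twist of the pair section spaces -/

/-- **`(χ₁, χ₂)`-pair sections times `ψ∘det` are `(χ₁·ψ̃⁻¹, χ₂·ψ)`-pair sections.** [cite: Rogawski1990, §12.1 p. 171, §13.3 p. 202] -/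
theorem isChiSectionPair_mul_detChar (ψ : ↥(TorusDict.torus c) →ₜ* ℂˣ) (hψ : TorusDict.IsAutomorphic c ψ)
    {χ₁ : HeckeCharacter E} {χ₂ : ↥(TorusDict.torus c) →ₜ* ℂˣ} {φ : (quasiSplit F E c 3).Adelic → ℂ} (hφ : IsChiSectionPair χ₁ χ₂ φ) :
    IsChiSectionPair (χ₁ * (TorusDict.pullback c h2 hc ψ hψ)⁻¹) (χ₂ * ψ) (fun x => φ x * ((detChar F E c h2 hc 3 ((StdForm.antidiagonal 3).over E) ψ hψ hJ x : ℂˣ) : ℂ)) := by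
  intro b hb g
  simp only [map_mul, Units.val_mul, hφ b hb g, detChar_borel_three h2 hc hJ ψ hψ hb, HeckeCharacter.mul_apply, ContinuousMonoidHom.mul_apply]
  ring

/-- **`V(χ₁, χ₂; K′, ω) · (ψ∘det) ⊆ V(χ₁·ψ̃⁻¹, χ₂·ψ; K′, ω·(ψ∘det)|_{K′})`** — `ψ∘det` preserves the level and twists the `K′`-type. [cite: Rogawski1990, §12.1 p. 171, §13.3 p. 202]
[cite: MoeglinWaldspurger1995, I.2.17] -/
theorem mul_detChar_mem_chiSectionSpacePair (ψ : ↥(TorusDict.torus c) →ₜ* ℂˣ) (hψ : TorusDict.IsAutomorphic c ψ)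
    {χ₁ : HeckeCharacter E} {χ₂ : ↥(TorusDict.torus c) →ₜ* ℂˣ} {K' : Subgroup (quasiSplit F E c 3).Adelic} {ω : ↥K' → ℂ} {φ : (quasiSplit F E c 3).Adelic → ℂ} (hφ : φ ∈ chiSectionSpacePair χ₁ χ₂ K' ω) :
    (fun x => φ x * ((detChar F E c h2 hc 3 ((StdForm.antidiagonal 3).over E) ψ hψ hJ x : ℂˣ) : ℂ)) ∈
      chiSectionSpacePair (χ₁ * (TorusDict.pullback c h2 hc ψ hψ)⁻¹) (χ₂ * ψ) K' (fun k => ω k * ((detChar F E c h2 hc 3 ((StdForm.antidiagonal 3).over E) ψ hψ hJ (k : (quasiSplit F E c 3).Adelic) : ℂˣ) : ℂ)) := by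
  refine mem_chiSectionSpacePair (isChiSectionPair_mul_detChar h2 hc hJ ψ hψ hφ.1) fun g k => ?_
  simp only [map_mul, Units.val_mul, apply_mul_of_mem hφ g k]
  ring

end Summit.HodgeConjecture.HodgeConjecture.Cruxes.H413.K2E1ChiDetCharBorelU3

end
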